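import Literature.AlgebraicGeometry.AbelianSchemes.AbelianSchemeSymplecticLevel
import Mathlib.LinearAlgebra.Matrix.ToLin
import Mathlib.Algebra.Module.ZMod
import HarnessLib

/-!
# Two symplectic lifts on one polarised fibre: the compatible tower of symplectic similitudes between them
# ([Deligne 1971] 4.12 (b); [Lan 2013] §1.3.6 Lemma 1.3.6.5; [Milne 2005] §6 Thm. 6.11)

Topic `AlgebraicGeometry/AbelianSchemes`; namespace
`Literature.AlgebraicGeometry.AbelianSchemes.AbelianSchemeOver.LevelStructure.SymplecticLift`.  THEOREMS ONLY (no
definition, no named fact, no instance, no notation, no `sorry`; net Literature debt 0).  Cell hodgecm-mathlib (D-0151),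
F-DAG leaf F-10 (b) «`classify` for the quotient `M/Γ`», brick (b1′) FILE 1 of 2: the CONVERSE of ★
`SymplecticLift.exists_twist` — two symplectic lifts `Λ₁, Λ₂` (D3 `LevelStructure.SymplecticLift`: towers
`lift_M : (ℤ/M)^{2g} ⥲ A_s[M](Ω)`, `N ∣ M`, with roots `ζ_M` and `ē^Θ_M(lift x, lift y) = ζ_M^{E_δ(x,y)}`) of two
level-`N` structures `η₁, η₂` at the SAME geometric point `s`, for the SAME witness divisor `Θ` and type `δ`, differ by
a COMPATIBLE TOWER `(G_M, n_M)_M` of symplectic similitudes of `(ℤ/M)^{2g}`; FILE 2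
(`SymplecticLiftsDifferByPrincipalLevelOne`) assembles the tower into one `γ ∈ K_δ(1) = GSp_δ(ẑ)` by ★
`exists_mem_principalLevelSubgroup_one_of_compatible` and reads its level-`N` layer as `η₂(s) = (η₁·γ̄_N)(s)`.
HC_CM is proved only modulo the 7 printed citations until rung 0 closes; this file discharges none of them
(count-neutral capital).

SETTING.  `A/S` an abelian scheme, `η₁ η₂ : LevelStructure g N A`, `s : Spec Ω → S` a point with values in a field `Ω`,
`Θ` a Cartier divisor on the fibre `A_s`, `Λ₁ : η₁.SymplecticLift s Θ δ`, `Λ₂ : η₂.SymplecticLift s Θ δ`.  For the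
similitude clauses `Ω` has characteristic `0` (`(M : Ω) ≠ 0` feeds the `pairing` field; symplectic lifts only exist
there).  Matrices are named `G…` in binders (`γ` is a notation token in this scope).

* §0 private arithmetic (`Pi.single` under `ZMod.castHom`, `val`-lifts of matrices, exponents of a primitive root agree
  mod `M`, `E_δ(G eᵢ, G eⱼ) = (Gᵀ E_δ G)ᵢⱼ`).
* §2 `exists_gl_lift_eq` — at each level `N ∣ M ≠ 0`, `Λ₂.lift_M x = Λ₁.lift_M (G_M x)` for a `G_M ∈ GL_{2g}(ℤ/M)`
  (the quotient `liftEquiv₁⁻¹ ∘ liftEquiv₂` is additive, hence `ℤ/M`-linear: Mathlib `AddMonoidHom.toZModLinearMap`,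
  `LinearMap.toMatrix'`); `typeFormMod_mulVec_eq_of_lift_eq` — `G_M` is a SIMILITUDE of `E_δ mod M` with multiplier
  the exponent `n_M`, `ζ₂ = ζ₁^{n_M}` (compare the two Weil pairings; `ζ₁` is primitive);
  `castHom_apply_eq_of_lift_eq` — `G_{kM} ≡ G_M (mod M)` (`lift_compat` of both lifts, injectivity of `Λ₁.lift_M`).
* §3 **`exists_frames_multipliers`** — integer lifts `A_M, B_M` of `G_M, G_M⁻¹` and integers `n_M, n′_M` satisfying
  VERBATIM the nine hypotheses `hA hB hAB hBA hn hn′ hnn′ hsymp` of ★ `exists_mem_principalLevelSubgroup_one_of_compatible`,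
  plus the reading clause `Λ₂.lift_M x = Λ₁.lift_M (Ā_M x)` (pattern of ★ `SiegelMarkingTowerFrames(Symplectic)`,
  which does the same for ONE lift read through a complex marking).

Mathlib searched (pin): `AddMonoidHom.toZModLinearMap`, `LinearMap.toMatrix'`, `Matrix.toLin'_toMatrix'`,
`Matrix.mulVec_single_one`, `IsPrimitiveRoot.eq_pow_of_pow_eq_one`, `IsPrimitiveRoot.pow_inj`,
`ZMod.intCast_eq_intCast_iff_dvd_sub`, `Units.inv_eq_of_mul_eq_one_right` (all used).

## References
* P. Deligne, *Travaux de Shimura*, Sém. Bourbaki 389 (1971), 4.12 (b) pp. 148–149. [Deligne1971TravauxShimura]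
* K.-W. Lan, *Arithmetic compactifications of PEL-type Shimura varieties* (2013), §1.3.6 Def. 1.3.6.1–1.3.6.2
  (pp. 79–80), Lemma 1.3.6.5 (p. 81). [Lan2013PELCompactifications]
* J. S. Milne, *Introduction to Shimura Varieties* (2005), §6 Thm. 6.11 p. 74 and p. 75. [Milne2005ShimuraVarieties]
* D. Mumford, J. Fogarty, F. Kirwan, *Geometric Invariant Theory*, 3rd ed. (1994), Ch. 7 §3 (p. 139). [MumfordFogartyKirwan1994]
-/

noncomputable section

universe u

open CategoryTheory Limits AlgebraicGeometry MonoidalCategory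
open scoped MonObj Matrix

namespace Literature.AlgebraicGeometry.AbelianSchemes.AbelianSchemeOver.LevelStructure.SymplecticLift

open Literature.AlgebraicGeometry.Motives Literature.AlgebraicGeometry.ModuliOfAbelianVarieties

variable {S : Scheme.{u}} {A : AbelianSchemeOver S} {g N : ℕ} {Ω : Type u} [Field Ω] {s : Spec (.of Ω) ⟶ S}
  {Θ : CartierDivisor (A.fibre s).toAbelianVariety.X.left} {δ : Fin g → ℕ}

/-! ### §0 Small lemmas -/

/-- `Pi.single j 1` is preserved by the reduction `ℤ/M′ → ℤ/M`. [folklore] -/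
private theorem castHom_comp_single {M M' : ℕ} (h : M ∣ M') (j : Fin g ⊕ Fin g) :
    (fun i => ZMod.castHom h (ZMod M) ((Pi.single j (1 : ZMod M') : Fin g ⊕ Fin g → ZMod M') i)) =
      (Pi.single j (1 : ZMod M) : Fin g ⊕ Fin g → ZMod M) := by
  funext i
  by_cases hij : i = j
  · subst hij; rw [Pi.single_eq_same, Pi.single_eq_same, map_one]
  · rw [Pi.single_eq_of_ne hij, Pi.single_eq_of_ne hij, map_zero]

/-- The entrywise `ZMod.val` lift of a matrix over `ℤ/M` reduces back to it. [folklore] -/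
private theorem map_val_map_intCast {M : ℕ} [NeZero M] (X : Matrix (Fin g ⊕ Fin g) (Fin g ⊕ Fin g) (ZMod M)) :
    (X.map fun z => ((z.val : ℕ) : ℤ)).map (Int.castRingHom (ZMod M)) = X := by
  ext i j
  simp

/-- Exponents of a primitive `M`-th root agree modulo `M`: `ζ ^ a = ζ ^ b → (M : ℤ) ∣ b − a`. [folklore] -/
private theorem intCast_dvd_sub_of_pow_eq_pow {R : Type*} [CommMonoid R] {M : ℕ} (hM : M ≠ 0) {ζ : R}
    (hζ : IsPrimitiveRoot ζ M) {a b : ℕ} (h : ζ ^ a = ζ ^ b) : (M : ℤ) ∣ (b : ℤ) - (a : ℤ) := by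
  have hred : ∀ c : ℕ, ζ ^ c = ζ ^ (c % M) := fun c => by
    conv_lhs => rw [← Nat.div_add_mod c M, pow_add, pow_mul, hζ.pow_eq_one, one_pow, one_mul]
  have hmod : a ≡ b [MOD M] :=
    hζ.pow_inj (Nat.mod_lt _ (Nat.pos_of_ne_zero hM)) (Nat.mod_lt _ (Nat.pos_of_ne_zero hM))
      (by rw [← hred, ← hred]; exact h)
  exact Nat.modEq_iff_dvd.1 hmod

/-- The reduced type form on two columns: `E_δ(G e_i, G e_j) = (Gᵀ · E_δ · G)_{ij}` in `ℤ/M`.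
[cite: Lan2013PELCompactifications, §1.3.6 Def. 1.3.6.1 (pp. 79–80)] -/
private theorem typeFormMod_mulVec_single_single (M : ℕ) (G : Matrix (Fin g ⊕ Fin g) (Fin g ⊕ Fin g) (ZMod M))
    (i j : Fin g ⊕ Fin g) :
    typeFormMod δ M (G *ᵥ Pi.single i 1) (G *ᵥ Pi.single j 1) =
      (Gᵀ * (typeForm δ).map (Int.castRingHom (ZMod M)) * G) i j := by
  have hcol : ∀ (k : Fin g ⊕ Fin g) (l : Fin g ⊕ Fin g), (G *ᵥ Pi.single k (1 : ZMod M)) l = G l k := by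
    intro k l
    simp [Matrix.mulVec, dotProduct, Pi.single_apply]
  simp only [typeFormMod_apply, hcol, Matrix.mul_apply, Matrix.transpose_apply, Matrix.map_apply,
    eq_intCast, Finset.sum_mul]
  rw [Finset.sum_comm]

/-! ### §2 At each level two symplectic lifts differ by a symplectic similitude of `(ℤ/M)^{2g}` -/

variable {η₁ η₂ : LevelStructure g N A} (Λ₁ : η₁.SymplecticLift s Θ δ) (Λ₂ : η₂.SymplecticLift s Θ δ)

/-- **At each level `N ∣ M` two symplectic lifts differ by a matrix**: `Λ₂.lift_M x = Λ₁.lift_M (G_M x)` for a (unique)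
`G_M ∈ GL_{2g}(ℤ/M)` (both `lift_M` are group isomorphisms `(ℤ/M)^{2g} ⥲ A_s[M](Ω)`, their quotient is additive, hence
`ℤ/M`-linear). [cite: Lan2013PELCompactifications, §1.3.6 Def. 1.3.6.2 (p. 80) and Lemma 1.3.6.5 (p. 81)]
[cite: MumfordFogartyKirwan1994, Ch. 7 §3 (p. 139)] -/
theorem exists_gl_lift_eq {M : ℕ} (hM : N ∣ M) (hM₀ : M ≠ 0) :
    ∃ G : GL (Fin g ⊕ Fin g) (ZMod M), ∀ x : Fin g ⊕ Fin g → ZMod M,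
      Λ₂.lift M (Multiplicative.ofAdd x) =
        Λ₁.lift M (Multiplicative.ofAdd ((G : Matrix (Fin g ⊕ Fin g) (Fin g ⊕ Fin g) (ZMod M)) *ᵥ x)) := by
  classical
  -- the transition `θ = lift₁⁻¹ ∘ lift₂` and its inverse, as additive maps
  let e : Multiplicative (Fin g ⊕ Fin g → ZMod M) ≃* Multiplicative (Fin g ⊕ Fin g → ZMod M) :=
    (Λ₂.liftEquiv hM hM₀).trans (Λ₁.liftEquiv hM hM₀).symm
  let θ : (Fin g ⊕ Fin g → ZMod M) ≃+ (Fin g ⊕ Fin g → ZMod M) := AddEquiv.toMultiplicative.symm e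
  have hθ : ∀ x, Λ₁.lift M (Multiplicative.ofAdd (θ x)) = Λ₂.lift M (Multiplicative.ofAdd x) := fun x => by
    change Λ₁.lift M (e (Multiplicative.ofAdd x)) = _
    change (Λ₁.liftEquiv hM hM₀) ((Λ₁.liftEquiv hM hM₀).symm (Λ₂.liftEquiv hM hM₀ (Multiplicative.ofAdd x))) = _
    rw [MulEquiv.apply_symm_apply]
    rfl
  let L : (Fin g ⊕ Fin g → ZMod M) →ₗ[ZMod M] (Fin g ⊕ Fin g → ZMod M) := θ.toAddMonoidHom.toZModLinearMap M
  let L' : (Fin g ⊕ Fin g → ZMod M) →ₗ[ZMod M] (Fin g ⊕ Fin g → ZMod M) := θ.symm.toAddMonoidHom.toZModLinearMap M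
  have hL : ∀ a, L a = θ a := fun a => rfl
  have hL' : ∀ a, L' a = θ.symm a := fun a => rfl
  have hLL' : L.comp L' = LinearMap.id := LinearMap.ext fun a => by simp [hL, hL']
  have hL'L : L'.comp L = LinearMap.id := LinearMap.ext fun a => by simp [hL, hL']
  let G : GL (Fin g ⊕ Fin g) (ZMod M) :=
    ⟨LinearMap.toMatrix' L, LinearMap.toMatrix' L',
      by rw [← LinearMap.toMatrix'_comp, hLL', LinearMap.toMatrix'_id],
      by rw [← LinearMap.toMatrix'_comp, hL'L, LinearMap.toMatrix'_id]⟩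
  refine ⟨G, fun x => ?_⟩
  have hG : (G : Matrix (Fin g ⊕ Fin g) (Fin g ⊕ Fin g) (ZMod M)) *ᵥ x = θ x := by
    change LinearMap.toMatrix' L *ᵥ x = θ x
    rw [← Matrix.toLin'_apply, Matrix.toLin'_toMatrix', hL]
  rw [hG, hθ]

/-- **The matrix `G_M` is a symplectic similitude mod `M`**, with multiplier the exponent `n` relating the two roots of
unity `ζ₂ = ζ₁^n` of the lifts: `E_δ(G x, G y) = n · E_δ(x, y)` in `ℤ/M` — compare the Weil pairings
`ē_M(Λ₂ x, Λ₂ y) = ζ₂^{E(x,y)}` and `ē_M(Λ₁ Gx, Λ₁ Gy) = ζ₁^{E(Gx,Gy)}` and use that `ζ₁` is a primitive `M`-th root.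
[cite: Lan2013PELCompactifications, §1.3.6 Lemma 1.3.6.5 (p. 81)] [cite: Deligne1971TravauxShimura, 4.12 (b) p. 149] -/
theorem typeFormMod_mulVec_eq_of_lift_eq {M : ℕ} (hM : N ∣ M) (hM₀ : M ≠ 0) (hMΩ : (M : Ω) ≠ 0)
    (G : Matrix (Fin g ⊕ Fin g) (Fin g ⊕ Fin g) (ZMod M))
    (hG : ∀ x, Λ₂.lift M (Multiplicative.ofAdd x) = Λ₁.lift M (Multiplicative.ofAdd (G *ᵥ x)))
    (n : ℕ) (hn : Λ₂.ζ M = Λ₁.ζ M ^ n) (x y : Fin g ⊕ Fin g → ZMod M) :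
    typeFormMod δ M (G *ᵥ x) (G *ᵥ y) = (n : ZMod M) * typeFormMod δ M x y := by
  haveI : NeZero M := ⟨hM₀⟩
  have h₂ := Λ₂.pairing hM hMΩ x y
  rw [hG x, hG y, Λ₁.pairing hM hMΩ, hn, ← pow_mul] at h₂
  -- `ζ₁^{E(Gx,Gy)} = ζ₁^{n E(x,y)}` with `ζ₁` primitive of order `M`; read the congruence in `ZMod M`
  have hdvd := intCast_dvd_sub_of_pow_eq_pow hM₀ (Λ₁.isPrimitiveRoot_ζ hM hM₀) h₂
  have hcast := (ZMod.intCast_eq_intCast_iff_dvd_sub _ _ M).2 hdvd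
  simp only [Nat.cast_mul, Int.cast_mul, Int.cast_natCast, ZMod.natCast_zmod_val] at hcast
  exact hcast

/-- **The matrices `G_M` are compatible along the tower**: `G_{kM} mod M = G_M` — reduce
`Λ₂.lift_{kM} x′ = Λ₁.lift_{kM} (G_{kM} x′)` modulo `M` through `lift_compat` of both lifts and use that `Λ₁.lift_M` is
injective. [cite: Lan2013PELCompactifications, §1.3.6 Lemma 1.3.6.5 (p. 81)] [cite: Deligne1971TravauxShimura, 4.12 (b) p. 149] -/
theorem castHom_apply_eq_of_lift_eq {M k : ℕ} (hM : N ∣ M) (hM₀ : M ≠ 0) (hk : k ≠ 0)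
    (GM : Matrix (Fin g ⊕ Fin g) (Fin g ⊕ Fin g) (ZMod M))
    (hGM : ∀ x, Λ₂.lift M (Multiplicative.ofAdd x) = Λ₁.lift M (Multiplicative.ofAdd (GM *ᵥ x)))
    (GkM : Matrix (Fin g ⊕ Fin g) (Fin g ⊕ Fin g) (ZMod (k * M)))
    (hGkM : ∀ x, Λ₂.lift (k * M) (Multiplicative.ofAdd x) = Λ₁.lift (k * M) (Multiplicative.ofAdd (GkM *ᵥ x)))
    (i j : Fin g ⊕ Fin g) :
    ZMod.castHom (Dvd.intro_left k rfl) (ZMod M) (GkM i j) = GM i j := by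
  -- for every `x'` of level `kM`: `G_M (x' mod M) = (G_{kM} x') mod M`
  have key : ∀ x' : Fin g ⊕ Fin g → ZMod (k * M),
      GM *ᵥ (fun l => ZMod.castHom (Dvd.intro_left k rfl) (ZMod M) (x' l)) =
        fun l => ZMod.castHom (Dvd.intro_left k rfl) (ZMod M) ((GkM *ᵥ x') l) := by
    intro x'
    have h2 := Λ₂.lift_compat k x' hM hM₀ hk
    rw [hGM, hGkM, ← Λ₁.lift_compat k (GkM *ᵥ x') hM hM₀ hk] at h2
    exact Multiplicative.ofAdd.injective ((Λ₁.lift_bijective hM hM₀).1 (Subtype.ext h2))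
  have h := congr_fun (key (Pi.single j 1)) i
  rw [castHom_comp_single (Dvd.intro_left k rfl) j] at h
  simp only [Matrix.mulVec_single_one, Matrix.col_apply] at h
  exact h.symm

/-! ### §3 The compatible integer frames and multipliers of the pair -/

/-- **THE FRAMES OF A PAIR OF SYMPLECTIC LIFTS** — verbatim the nine hypotheses `hA hB hAB hBA hn hn′ hnn′ hsymp` of ★
`exists_mem_principalLevelSubgroup_one_of_compatible` plus the READING clause `Λ₂.lift_M x = Λ₁.lift_M (Ā_M x)`:
integer matrices `A_M, B_M` (`N ∣ M ≠ 0`; junk elsewhere) lifting `G_M = Λ₁.lift_M⁻¹ ∘ Λ₂.lift_M` and its inverse,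
compatible along the tower and mutually inverse mod `M`, and integers `n_M, n′_M` with `ζ₂ = ζ₁^{n_M}`, `ζ₁ = ζ₂^{n′_M}`,
compatible, `n n′ ≡ 1`, and `A_Mᵀ E_δ A_M ≡ n_M E_δ (mod M)` (the similitude clause, from the Weil pairings of the two
lifts).  Characteristic `0` is where symplectic lifts live (`(M : Ω) ≠ 0` feeds `pairing`).
[cite: Deligne1971TravauxShimura, 4.12 (b) pp. 148–149] [cite: Lan2013PELCompactifications, §1.3.6 Lemma 1.3.6.5 (p. 81)]
[cite: Milne2005ShimuraVarieties, §6 Thm. 6.11 p. 74 and p. 75] -/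
theorem exists_frames_multipliers [CharZero Ω] :
    ∃ (A B : ℕ → Matrix (Fin g ⊕ Fin g) (Fin g ⊕ Fin g) ℤ) (n n' : ℕ → ℤ),
      (∀ M M' : ℕ, M ≠ 0 → M' ≠ 0 → N ∣ M → M ∣ M' → ∀ i j, (M : ℤ) ∣ A M' i j - A M i j) ∧
      (∀ M M' : ℕ, M ≠ 0 → M' ≠ 0 → N ∣ M → M ∣ M' → ∀ i j, (M : ℤ) ∣ B M' i j - B M i j) ∧
      (∀ M, M ≠ 0 → N ∣ M → ∀ i j, (M : ℤ) ∣ (A M * B M) i j - (1 : Matrix _ _ ℤ) i j) ∧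
      (∀ M, M ≠ 0 → N ∣ M → ∀ i j, (M : ℤ) ∣ (B M * A M) i j - (1 : Matrix _ _ ℤ) i j) ∧
      (∀ M M' : ℕ, M ≠ 0 → M' ≠ 0 → N ∣ M → M ∣ M' → (M : ℤ) ∣ n M' - n M) ∧
      (∀ M M' : ℕ, M ≠ 0 → M' ≠ 0 → N ∣ M → M ∣ M' → (M : ℤ) ∣ n' M' - n' M) ∧
      (∀ M, M ≠ 0 → N ∣ M → (M : ℤ) ∣ n M * n' M - 1) ∧
      (∀ M, M ≠ 0 → N ∣ M → ∀ i j,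
        (M : ℤ) ∣ ((A M)ᵀ * typeForm δ * A M) i j - (n M • typeForm δ) i j) ∧
      ∀ ⦃M : ℕ⦄, N ∣ M → M ≠ 0 → ∀ x : Fin g ⊕ Fin g → ZMod M,
        Λ₂.lift M (Multiplicative.ofAdd x) =
          Λ₁.lift M (Multiplicative.ofAdd ((A M).map (Int.castRingHom (ZMod M)) *ᵥ x)) := by
  classical
  /- (1) the matrices `G_M` (junk `1` off the levels) -/
  have hexG : ∀ M : ℕ, ∃ G : GL (Fin g ⊕ Fin g) (ZMod M), N ∣ M → M ≠ 0 →
      ∀ x, Λ₂.lift M (Multiplicative.ofAdd x) =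
        Λ₁.lift M (Multiplicative.ofAdd ((G : Matrix (Fin g ⊕ Fin g) (Fin g ⊕ Fin g) (ZMod M)) *ᵥ x)) := fun M => by
    by_cases h : N ∣ M ∧ M ≠ 0
    · obtain ⟨G, hG⟩ := exists_gl_lift_eq Λ₁ Λ₂ h.1 h.2
      exact ⟨G, fun _ _ => hG⟩
    · exact ⟨1, fun h1 h2 => (h ⟨h1, h2⟩).elim⟩
  choose G hG using hexG
  /- (2) the exponents `ζ₂ = ζ₁ ^ n`, `ζ₁ = ζ₂ ^ n'` -/
  have hexn : ∀ M : ℕ, ∃ e : ℕ, N ∣ M → M ≠ 0 → Λ₂.ζ M = Λ₁.ζ M ^ e := fun M => by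
    by_cases h : N ∣ M ∧ M ≠ 0
    · haveI : NeZero M := ⟨h.2⟩
      obtain ⟨e, -, he⟩ :=
        (Λ₁.isPrimitiveRoot_ζ h.1 h.2).eq_pow_of_pow_eq_one (Λ₂.isPrimitiveRoot_ζ h.1 h.2).pow_eq_one
      exact ⟨e, fun _ _ => he.symm⟩
    · exact ⟨0, fun h1 h2 => (h ⟨h1, h2⟩).elim⟩
  have hexn' : ∀ M : ℕ, ∃ e : ℕ, N ∣ M → M ≠ 0 → Λ₁.ζ M = Λ₂.ζ M ^ e := fun M => by
    by_cases h : N ∣ M ∧ M ≠ 0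
    · haveI : NeZero M := ⟨h.2⟩
      obtain ⟨e, -, he⟩ :=
        (Λ₂.isPrimitiveRoot_ζ h.1 h.2).eq_pow_of_pow_eq_one (Λ₁.isPrimitiveRoot_ζ h.1 h.2).pow_eq_one
      exact ⟨e, fun _ _ => he.symm⟩
    · exact ⟨0, fun h1 h2 => (h ⟨h1, h2⟩).elim⟩
  choose n hn using hexn
  choose n' hn' using hexn'
  /- (3) compatibility of `G` and of `G⁻¹` along the tower -/
  have hGc : ∀ {M : ℕ} (k : ℕ), N ∣ M → M ≠ 0 → k ≠ 0 → ∀ i j,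
      ZMod.castHom (Dvd.intro_left k rfl) (ZMod M)
          ((G (k * M) : Matrix (Fin g ⊕ Fin g) (Fin g ⊕ Fin g) (ZMod (k * M))) i j) =
        (G M : Matrix (Fin g ⊕ Fin g) (Fin g ⊕ Fin g) (ZMod M)) i j :=
    fun {M} k hM hM0 hk i j => castHom_apply_eq_of_lift_eq Λ₁ Λ₂ hM hM0 hk _ (hG M hM hM0) _
      (hG (k * M) (Dvd.dvd.mul_left hM k) (Nat.mul_ne_zero hk hM0)) i j
  have hGc' : ∀ {M : ℕ} (k : ℕ), N ∣ M → M ≠ 0 → k ≠ 0 → ∀ i j,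
      ZMod.castHom (Dvd.intro_left k rfl) (ZMod M) (((G (k * M))⁻¹).val i j) = ((G M)⁻¹).val i j := by
    intro M k hM hM0 hk i j
    let R := (ZMod.castHom (Dvd.intro_left k rfl) (ZMod M)).mapMatrix (m := Fin g ⊕ Fin g)
    have hred : R (G (k * M) : Matrix (Fin g ⊕ Fin g) (Fin g ⊕ Fin g) (ZMod (k * M))) =
        (G M : Matrix (Fin g ⊕ Fin g) (Fin g ⊕ Fin g) (ZMod M)) := by
      ext i' j'
      exact hGc k hM hM0 hk i' j'
    have hP : (G M : Matrix (Fin g ⊕ Fin g) (Fin g ⊕ Fin g) (ZMod M)) * R ((G (k * M))⁻¹).val = 1 := by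
      rw [← hred, ← map_mul, Units.mul_inv, map_one]
    have hinv := Units.inv_eq_of_mul_eq_one_right hP
    exact (congr_fun (congr_fun hinv i) j).symm
  /- (4) the integer lifts -/
  refine ⟨fun M => (G M : Matrix (Fin g ⊕ Fin g) (Fin g ⊕ Fin g) (ZMod M)).map fun z => ((z.val : ℕ) : ℤ),
    fun M => ((G M)⁻¹).val.map fun z => ((z.val : ℕ) : ℤ),
    fun M => (n M : ℤ), fun M => (n' M : ℤ), ?_, ?_, ?_, ?_, ?_, ?_, ?_, ?_, ?_⟩
  · -- hA
    intro M M' hM0 hM'0 hM hMM' i j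
    obtain ⟨k, rfl⟩ := hMM'
    have hk : k ≠ 0 := fun hk => hM'0 (by rw [hk, mul_zero])
    haveI : NeZero M := ⟨hM0⟩
    haveI : NeZero (k * M) := ⟨Nat.mul_ne_zero hk hM0⟩
    rw [mul_comm M k, ← ZMod.intCast_eq_intCast_iff_dvd_sub]
    simp only [Matrix.map_apply, Int.cast_natCast]
    rw [ZMod.natCast_zmod_val, ← ZMod.cast_eq_val, ← ZMod.castHom_apply (h := Dvd.intro_left k rfl)]
    exact (hGc k hM hM0 hk i j).symm
  · -- hB
    intro M M' hM0 hM'0 hM hMM' i j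
    obtain ⟨k, rfl⟩ := hMM'
    have hk : k ≠ 0 := fun hk => hM'0 (by rw [hk, mul_zero])
    haveI : NeZero M := ⟨hM0⟩
    haveI : NeZero (k * M) := ⟨Nat.mul_ne_zero hk hM0⟩
    rw [mul_comm M k, ← ZMod.intCast_eq_intCast_iff_dvd_sub]
    simp only [Matrix.map_apply, Int.cast_natCast]
    rw [ZMod.natCast_zmod_val, ← ZMod.cast_eq_val, ← ZMod.castHom_apply (h := Dvd.intro_left k rfl)]
    exact (hGc' k hM hM0 hk i j).symm
  · -- hAB
    intro M hM0 hM i j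
    haveI : NeZero M := ⟨hM0⟩
    rw [← ZMod.intCast_eq_intCast_iff_dvd_sub]
    have e : ((G M : Matrix (Fin g ⊕ Fin g) (Fin g ⊕ Fin g) (ZMod M)).map fun z => ((z.val : ℕ) : ℤ)).map
          (Int.castRingHom (ZMod M)) *
        (((G M)⁻¹).val.map fun z => ((z.val : ℕ) : ℤ)).map (Int.castRingHom (ZMod M)) = 1 := by
      rw [map_val_map_intCast, map_val_map_intCast, Units.mul_inv]
    rw [← Matrix.map_mul] at e
    have e' := congr_fun (congr_fun e i) j
    rw [Matrix.map_apply, eq_intCast] at e'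
    rw [e', Matrix.one_apply, Matrix.one_apply]
    split_ifs <;> simp
  · -- hBA
    intro M hM0 hM i j
    haveI : NeZero M := ⟨hM0⟩
    rw [← ZMod.intCast_eq_intCast_iff_dvd_sub]
    have e : (((G M)⁻¹).val.map fun z => ((z.val : ℕ) : ℤ)).map (Int.castRingHom (ZMod M)) *
        ((G M : Matrix (Fin g ⊕ Fin g) (Fin g ⊕ Fin g) (ZMod M)).map fun z => ((z.val : ℕ) : ℤ)).map
          (Int.castRingHom (ZMod M)) = 1 := by
      rw [map_val_map_intCast, map_val_map_intCast, Units.inv_mul]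
    rw [← Matrix.map_mul] at e
    have e' := congr_fun (congr_fun e i) j
    rw [Matrix.map_apply, eq_intCast] at e'
    rw [e', Matrix.one_apply, Matrix.one_apply]
    split_ifs <;> simp
  · -- hn : compatibility of `n`
    intro M M' hM0 hM'0 hM hMM'
    obtain ⟨k, rfl⟩ := hMM'
    have hk : k ≠ 0 := fun hk => hM'0 (by rw [hk, mul_zero])
    have hkM : N ∣ k * M := Dvd.dvd.mul_left hM k
    have hkM0 : k * M ≠ 0 := Nat.mul_ne_zero hk hM0
    rw [mul_comm M k]
    refine intCast_dvd_sub_of_pow_eq_pow hM0 (Λ₁.isPrimitiveRoot_ζ hM hM0) ?_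
    -- `ζ₁_M ^ n_M = ζ₂_M = ζ₂_{kM} ^ k = ζ₁_{kM} ^ (n_{kM} k) = ζ₁_M ^ n_{kM}`
    rw [← hn M hM hM0, ← Λ₂.ζ_pow k hM hM0 hk, hn (k * M) hkM hkM0, ← pow_mul, pow_mul', Λ₁.ζ_pow k hM hM0 hk]
  · -- hn' : compatibility of `n'`
    intro M M' hM0 hM'0 hM hMM'
    obtain ⟨k, rfl⟩ := hMM'
    have hk : k ≠ 0 := fun hk => hM'0 (by rw [hk, mul_zero])
    have hkM : N ∣ k * M := Dvd.dvd.mul_left hM k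
    have hkM0 : k * M ≠ 0 := Nat.mul_ne_zero hk hM0
    rw [mul_comm M k]
    refine intCast_dvd_sub_of_pow_eq_pow hM0 (Λ₂.isPrimitiveRoot_ζ hM hM0) ?_
    rw [← hn' M hM hM0, ← Λ₁.ζ_pow k hM hM0 hk, hn' (k * M) hkM hkM0, ← pow_mul, pow_mul', Λ₂.ζ_pow k hM hM0 hk]
  · -- hnn' : `n n' ≡ 1`
    intro M hM0 hM
    have h : Λ₁.ζ M ^ 1 = Λ₁.ζ M ^ (n M * n' M) := by
      rw [pow_one, pow_mul, ← hn M hM hM0, ← hn' M hM hM0]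
    have h2 := intCast_dvd_sub_of_pow_eq_pow hM0 (Λ₁.isPrimitiveRoot_ζ hM hM0) h
    rwa [Nat.cast_mul, Nat.cast_one] at h2
  · -- hsymp : `A_Mᵀ E A_M ≡ n_M E (mod M)` from the two Weil pairings
    intro M hM0 hM i j
    haveI : NeZero M := ⟨hM0⟩
    have hMΩ : (M : Ω) ≠ 0 := Nat.cast_ne_zero.2 hM0
    have hzmod := typeFormMod_mulVec_eq_of_lift_eq Λ₁ Λ₂ hM hM0 hMΩ _ (hG M hM hM0) (n M) (hn M hM hM0)
      (Pi.single i 1) (Pi.single j 1)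
    have hE1 : typeFormMod δ M (Pi.single i 1) (Pi.single j 1) = ((typeForm δ i j : ℤ) : ZMod M) := by
      simp [typeFormMod_apply, Pi.single_apply]
    rw [typeFormMod_mulVec_single_single, hE1] at hzmod
    -- back to `ℤ`
    rw [← ZMod.intCast_eq_intCast_iff_dvd_sub]
    have hL : (((((G M : Matrix (Fin g ⊕ Fin g) (Fin g ⊕ Fin g) (ZMod M)).map fun z => ((z.val : ℕ) : ℤ))ᵀ *
          typeForm δ * (G M : Matrix (Fin g ⊕ Fin g) (Fin g ⊕ Fin g) (ZMod M)).map fun z => ((z.val : ℕ) : ℤ)) i j :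
          ℤ) : ZMod M) =
        ((G M : Matrix (Fin g ⊕ Fin g) (Fin g ⊕ Fin g) (ZMod M))ᵀ * (typeForm δ).map (Int.castRingHom (ZMod M)) *
          (G M : Matrix (Fin g ⊕ Fin g) (Fin g ⊕ Fin g) (ZMod M))) i j := by
      have e := RingHom.map_matrix_mul
        (((G M : Matrix (Fin g ⊕ Fin g) (Fin g ⊕ Fin g) (ZMod M)).map fun z => ((z.val : ℕ) : ℤ))ᵀ * typeForm δ)
        ((G M : Matrix (Fin g ⊕ Fin g) (Fin g ⊕ Fin g) (ZMod M)).map fun z => ((z.val : ℕ) : ℤ)) i j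
        (Int.castRingHom (ZMod M))
      rw [eq_intCast] at e
      rw [e, Matrix.map_mul, ← Matrix.transpose_map]
      simp only [map_val_map_intCast]
    have hR : ((((n M : ℤ) • typeForm δ) i j : ℤ) : ZMod M) = ((n M : ℕ) : ZMod M) * ((typeForm δ i j : ℤ) : ZMod M) := by
      rw [Matrix.smul_apply, smul_eq_mul, Int.cast_mul, Int.cast_natCast]
    rw [hL, hR]
    exact hzmod.symm
  · -- READING
    intro M hM hM0 x
    haveI : NeZero M := ⟨hM0⟩
    rw [map_val_map_intCast]
    exact hG M hM hM0 x

end Literature.AlgebraicGeometry.AbelianSchemes.AbelianSchemeOver.LevelStructure.SymplecticLift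

end
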